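/-
Origin: expansion seat `planner-pub-hodgecm-pv01-g4-0`, handover #3 v2 2026-08-18T06:53:17Z (`HOME/pub-hodgecm-pv01-g4/lean/Pv01g4/EndStateVerdict.lean`, md5 20bd532f, 97 lines);
landed by the gen-7 packager in gate run 25 as `HodgeCM/PerL34/EndStateVerdict.lean` (import ^import Pv[0-9]+g[0-9]+\.PerL34\.→import HodgeCM.PerL34. ×1; import ^import Pv[0-9]+g[0-9]+\.→import HodgeCM.PerL34. ×1).
-/
/-
Origin: planner-pub-hodgecm-pv01-g4-0 (unit pub-hodgecm-pv01-g4, DAG-NODE PROVER #01 gen 4), 2026-08-18.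
Proposed tree path: `HodgeCM/PerL34/EndStateVerdict.lean` (new, additive; fresh namespace `HodgeCM.PerL34.EndStateVerdict`).
Imports this seat's `Pv01g4.EndStateCensus` (handover #2 ↦ `HodgeCM.PerL34.EndStateCensus`) and pv02-g3's run-25
`ClassVanishing` (their handover #15, source `pub-hodgecm-pv02-g3/lean/Pv02g3/PerL34/ClassVanishing.lean` c8c329a65938
↦ `HodgeCM.PerL34.ClassVanishing`); both import lines are rewritten by the packager's GENERIC rule
`import Pv..g..[.PerL34].X` ↦ `import HodgeCM.PerL34.X` (no special case).  Elaborated here against the byte-faithful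
copy `SimPv02g3.ClassVanishing` (46de4a5defe1) of pv02-g3's landing simulation, reached through a local shim module
`Pv02g3.PerL34.ClassVanishing` under this seat's WIP root (the shim never lands).  KERNEL: nothing cited, nothing asserted.
-/
import Summits.HodgeConjecture.HodgeCM.PerL34.EndStateCensus
import Summits.HodgeConjecture.HodgeCM.PerL34.ClassVanishing

/-!
# The S1 verdict and the end-state census with the `SplitHolConfig` price PAID

pv02-g3's `SplitHolForms.splitHolConfig : S1StrengthCR.SplitHolConfig` (run 25; `orbitSpansDisjoint`, kernel) removes
the `T`-free binder `C` from `EndStateStrength` / `EndStateCensus`.  What is left as a price, beyond binders the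
headline `AssemblyRoutes.perL_of_openCharsWeilLeavesCRΔ` already carries, is ONLY the DEFINITIONAL level-freeness
of theta one-forms `T.Fact_coverTheta` (and only for the direction leaves ⇒ records):

* `weilStepsInputCRΔ_iff_thetaWedge_of_leaves (M h07 h09a h09b hM38 hAlb hbr hch) (hcov) :
    WeilStepsInputCRΔ T ↔ T.Open_thetaWedge ∧ ThetaMeet T` — inside the end state the S1 binder IS node N33's A6
  up to the 0-type `ThetaMeet`;
* `headlineBundle_iff_dictLeaves (M h07 h09a h09b hM38) (hcov) (Pc) : HeadlineBundle T Pc ↔ DictLeaves T Pc`.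
-/

set_option autoImplicit false

noncomputable section

namespace HodgeCM
namespace PerL34
namespace EndStateVerdict

open HodgeCM.Prior.Perl34File HodgeCM.Prior.Perl34File.Perl34 HodgeCM.PerL34.ArchC
open HodgeCM.PerL34.EndStateStrength HodgeCM.PerL34.EndStateCensus HodgeCM.PerL34.CharSpansFinal
  HodgeCM.PerL34.CharSpansCR HodgeCM.PerL34.S1StrengthCR
open HodgeCM.PerL34.SplitHolForms (splitHolConfig)

variable {U : Universe} (T : U.ThetaModel)

/-- **S1 inside the end state, leaf form, `C`-free**: given N07, N09a, N09b, N12a, N19w, N31 and `Fact_coverTheta`,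
`WeilStepsInputCRΔ T ↔ A6 ∧ ThetaMeet`. -/
theorem weilStepsInputCRΔ_iff_thetaWedge (M : U.ModelAxioms) (hHR : U.Fact_hodgeRiemann20)
    (hE : T.Fact_embCover) (hI : T.Fact_innerEmb) (hsub : T.Open_thetaSub) (hgen : T.Open_thetaGen12)
    (hch : T.Open_chars) (hcov : T.Fact_coverTheta) :
    WeilStepsInputCRΔ T ↔ T.Open_thetaWedge ∧ ThetaMeet T :=
  EndStateStrength.weilStepsInputCRΔ_iff_thetaWedge T M hHR hE hI hsub hgen hch splitHolConfig hcov

/-- The same for the CR binder. -/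
theorem weilStepsInputCR_iff_thetaWedge (M : U.ModelAxioms) (hHR : U.Fact_hodgeRiemann20)
    (hE : T.Fact_embCover) (hI : T.Fact_innerEmb) (hsub : T.Open_thetaSub) (hgen : T.Open_thetaGen12)
    (hch : T.Open_chars) (hcov : T.Fact_coverTheta) :
    WeilStepsInputCR T ↔ T.Open_thetaWedge ∧ ThetaMeet T :=
  EndStateStrength.weilStepsInputCR_iff_thetaWedge T M hHR hE hI hsub hgen hch splitHolConfig hcov

/-- **S1 inside the end state, with the headline's literal binders, `C`-free.** -/
theorem weilStepsInputCRΔ_iff_thetaWedge_of_leaves (M : U.ModelAxioms) (h07 : N07_hodgeRiemann20 U)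
    (h09a : N09a_embCover T) (h09b : N09b_innerEmb T) (hM38 : U.Fact_cmInflation)
    (hAlb : T.Fact_thetaAlbanese)
    (hbr : ∀ {L : CMField} {ι₁ : L →+* ℂ} (V : HermSpace3 L ι₁) (c : SeesawCtx L), T.GoodCtx ι₁ c →
      Nonempty (SeesawDictionary.SeesawBridge T V c (T.t12 V c) 0 1))
    (hch : T.Open_chars) (hcov : T.Fact_coverTheta) :
    WeilStepsInputCRΔ T ↔ T.Open_thetaWedge ∧ ThetaMeet T :=
  EndStateStrength.weilStepsInputCRΔ_iff_thetaWedge_of_leaves T M h07 h09a h09b hM38 hAlb hbr hch splitHolConfig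
    hcov

/-- **A6 + `ThetaMeet` MANUFACTURE the headline's S1 binder** (non-vacuity direction alone, `C`-free). -/
theorem weilStepsInputCRΔ_of_thetaWedge (M : U.ModelAxioms) (hHR : U.Fact_hodgeRiemann20)
    (hE : T.Fact_embCover) (hI : T.Fact_innerEmb) (hsub : T.Open_thetaSub) (hgen : T.Open_thetaGen12)
    (hch : T.Open_chars) (hcov : T.Fact_coverTheta) (hw : T.Open_thetaWedge) (hm : ThetaMeet T) :
    WeilStepsInputCRΔ T :=
  (weilStepsInputCRΔ_iff_thetaWedge T M hHR hE hI hsub hgen hch hcov).2 ⟨hw, hm⟩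

/-- **The end-state census, `C`-free**: the headline's record bundle is worth exactly the dictionary leaves,
modulo the model axioms, N07, N09a, N09b, M38 and the DEFINITIONAL `Fact_coverTheta`. -/
theorem headlineBundle_iff_dictLeaves (M : U.ModelAxioms) (hHR : U.Fact_hodgeRiemann20) (hE : T.Fact_embCover)
    (hI : T.Fact_innerEmb) (hM38 : U.Fact_cmInflation) (hcov : T.Fact_coverTheta)
    (Pc : ∀ {L : CMField} {ι₁ : L →+* ℂ} (V : HermSpace3 L ι₁) (c : SeesawCtx L),
      C4a.PointedCore (T.core V c)) :
    HeadlineBundle T Pc ↔ DictLeaves T Pc :=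
  EndStateCensus.headlineBundle_iff_dictLeaves T M hHR hE hI hM38 splitHolConfig hcov Pc

/-- **Records from leaves, `C`-free**: the dictionary leaves rebuild the whole headline bundle. -/
theorem headlineBundle_of_dictLeaves (M : U.ModelAxioms) (hHR : U.Fact_hodgeRiemann20) (hE : T.Fact_embCover)
    (hI : T.Fact_innerEmb) (hcov : T.Fact_coverTheta)
    (Pc : ∀ {L : CMField} {ι₁ : L →+* ℂ} (V : HermSpace3 L ι₁) (c : SeesawCtx L),
      C4a.PointedCore (T.core V c))
    (h : DictLeaves T Pc) : HeadlineBundle T Pc :=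
  EndStateCensus.headlineBundle_of_dictLeaves T M hHR hE hI splitHolConfig hcov Pc h

end EndStateVerdict
end PerL34
end HodgeCM

end
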